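import Literature.Geometry.Lorentzian.KillingOnConfinedComplete
import HarnessLib

/-!
# Uniqueness of integral curves of a local Killing field inside its open domain

For a Killing field `Z` of a `C^∞` pseudo-Riemannian metric ON an open set `W` (`IsKillingFieldOn`;
`Z` is only known to be smooth on `W`), two integral curves of `Z` on an open order-connected
parameter set `J`, both mapping `J` into `W` and agreeing at one time of `J`, agree on `J`.  This is
Lee 2013, Thm. 9.12 (a) (uniqueness of integral curves; the tree's
`Manifold.eqOn_of_isMIntegralCurveOn` for GLOBAL `C¹` fields) read on the open sub-carrier `↥W`,
where `Z|W` is a global smooth field (`IsKillingFieldOn.isKillingField_restrict`): the curves are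
modified off `J` so as to map into `W` everywhere, lifted to `↥W`
(`mdifferentiableAt_subtypeVal_comp_curve_iff`, `hasMFDerivAt_subtypeVal`), and compared there.

Everything here is proved; no definitions, no named facts.  Used by the crux
`NonTrappingHawkingRigidity` (stub `stub_farAxialSeed`: orbits of the continued axial field through
the near-horizon region are the orbits of the given circle action).

## References
* J. M. Lee, *Introduction to Smooth Manifolds*, 2nd ed. (2013), Thm. 9.12 (a). [LeeSmoothManifolds2013]
-/

noncomputable section

open Set Filter Function Bundle TopologicalSpace VectorField Literature.Geometry.Manifold
open scoped Manifold ContDiff Topology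

namespace Literature.Geometry.Lorentzian

namespace PseudoRiemannianMetric

universe u

variable {d : ℕ} {M : Type u} [TopologicalSpace M] [ChartedSpace (EuclideanSpace ℝ (Fin d)) M]
  [IsManifold (𝓡 d) ∞ M] [T2Space M]
  {g : PseudoRiemannianMetric (𝓡 d) ∞ (EuclideanSpace ℝ (Fin d)) (TangentSpace (𝓡 d) : M → Type _)}
  [g.HasLeviCivita]

omit [IsManifold (𝓡 d) ∞ M] [T2Space M] in
/-- **Lifting integral curves on a parameter set to the open sub-carrier.** If `η : ℝ → ↥W` composed
with the inclusion is an integral curve of `Z` on the open `J`, then `η` is an integral curve of `Z|W`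
on `J` (`dι = id`). Lee 2013, Prop. 3.9. [folklore] -/
theorem isMIntegralCurveOn_of_subtypeVal_comp (U : Opens M) {Z : Π x : M, TangentSpace (𝓡 d) x}
    {η : ℝ → U} {J : Set ℝ} (hJ : IsOpen J) (hη : IsMIntegralCurveOn (Subtype.val ∘ η) Z J) :
    IsMIntegralCurveOn (I := 𝓡 d) η (fun y : U ↦ (Z y.1 : TangentSpace (𝓡 d) y)) J := by
  intro t ht
  have hAt : HasMFDerivAt 𝓘(ℝ, ℝ) (𝓡 d) (Subtype.val ∘ η) t
      ((1 : ℝ →L[ℝ] ℝ).smulRight (Z ((Subtype.val ∘ η) t))) :=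
    (hη t ht).hasMFDerivAt (hJ.mem_nhds ht)
  have hdiff : MDifferentiableAt 𝓘(ℝ, ℝ) (𝓡 d) η t :=
    (mdifferentiableAt_subtypeVal_comp_curve_iff U).1 hAt.mdifferentiableAt
  have hη' : HasMFDerivAt 𝓘(ℝ, ℝ) (𝓡 d) η t (mfderiv 𝓘(ℝ, ℝ) (𝓡 d) η t) := hdiff.hasMFDerivAt
  have hcomp : HasMFDerivAt 𝓘(ℝ, ℝ) (𝓡 d) (Subtype.val ∘ η) t
      ((ContinuousLinearMap.id ℝ (EuclideanSpace ℝ (Fin d))).comp (mfderiv 𝓘(ℝ, ℝ) (𝓡 d) η t)) :=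
    (hasMFDerivAt_subtypeVal (I' := 𝓡 d) (η t)).comp t hη'
  rw [ContinuousLinearMap.id_comp] at hcomp
  have heq : mfderiv 𝓘(ℝ, ℝ) (𝓡 d) η t = (1 : ℝ →L[ℝ] ℝ).smulRight (Z ((Subtype.val ∘ η) t)) :=
    hcomp.mfderiv.symm.trans hAt.mfderiv
  rw [heq] at hη'
  exact hη'.hasMFDerivWithinAt

/-- **Uniqueness of integral curves of a local Killing field inside its domain.** Let `Z` be a Killing
field of `g` on the open `W`, `J ⊆ ℝ` open and order-connected, `t₀ ∈ J`, and `γ₁, γ₂` integral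
curves of `Z` on `J` with `γ₁(J), γ₂(J) ⊆ W` and `γ₁ t₀ = γ₂ t₀`. Then `γ₁ = γ₂` on `J`.
Lee 2013, Thm. 9.12 (a), read on the open sub-carrier `↥W`. [cite: LeeSmoothManifolds2013, Thm. 9.12 (a)] -/
theorem IsKillingFieldOn.eqOn_of_isMIntegralCurveOn {W : Set M} (hWo : IsOpen W)
    {Z : Π x : M, TangentSpace (𝓡 d) x} (hZ : g.IsKillingFieldOn Z W) {γ₁ γ₂ : ℝ → M} {J : Set ℝ}
    (hJ : IsOpen J) (hJc : J.OrdConnected) {t₀ : ℝ} (ht₀ : t₀ ∈ J)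
    (hγ₁ : IsMIntegralCurveOn γ₁ Z J) (hγ₂ : IsMIntegralCurveOn γ₂ Z J)
    (hW₁ : ∀ t ∈ J, γ₁ t ∈ W) (hW₂ : ∀ t ∈ J, γ₂ t ∈ W) (h0 : γ₁ t₀ = γ₂ t₀) : EqOn γ₁ γ₂ J := by
  classical
  set U : Opens M := ⟨W, hWo⟩ with hU
  set gU := g.restrict PseudoRiemannianMetric.contMDiff_restrict_holds U with hgU
  haveI hLCU : gU.HasLeviCivita := gU.hasLeviCivita
  set ZU : Π y : U, TangentSpace (𝓡 d) y := fun y ↦ (Z y.1 : TangentSpace (𝓡 d) y)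
  have hZU : gU.IsKillingField ZU := hZ.isKillingField_restrict U hWo Subset.rfl
  have hZU1 : ContMDiff (𝓡 d) (𝓡 d).tangent 1
      (fun y : U ↦ (⟨y, ZU y⟩ : TangentBundle (𝓡 d) U)) :=
    hZU.contMDiff.of_le (by exact_mod_cast le_top)
  -- modify the curves off `J` so that they map into `W` everywhere, and lift
  set δ₁ : ℝ → M := fun t ↦ if t ∈ J then γ₁ t else γ₁ t₀ with hδ₁
  set δ₂ : ℝ → M := fun t ↦ if t ∈ J then γ₂ t else γ₁ t₀ with hδ₂
  have hδ₁W : ∀ t, δ₁ t ∈ W := fun t ↦ by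
    by_cases ht : t ∈ J
    · simp only [hδ₁, if_pos ht]; exact hW₁ t ht
    · simp only [hδ₁, if_neg ht]; exact hW₁ t₀ ht₀
  have hδ₂W : ∀ t, δ₂ t ∈ W := fun t ↦ by
    by_cases ht : t ∈ J
    · simp only [hδ₂, if_pos ht]; exact hW₂ t ht
    · simp only [hδ₂, if_neg ht]; exact hW₁ t₀ ht₀
  have hδ₁J : EqOn δ₁ γ₁ J := fun t ht ↦ by simp only [hδ₁, if_pos ht]
  have hδ₂J : EqOn δ₂ γ₂ J := fun t ht ↦ by simp only [hδ₂, if_pos ht]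
  have hδ₁c : IsMIntegralCurveOn δ₁ Z J := hγ₁.congr_of_eqOn_isOpen hJ hδ₁J
  have hδ₂c : IsMIntegralCurveOn δ₂ Z J := hγ₂.congr_of_eqOn_isOpen hJ hδ₂J
  set η₁ : ℝ → U := fun t ↦ ⟨δ₁ t, hδ₁W t⟩ with hη₁
  set η₂ : ℝ → U := fun t ↦ ⟨δ₂ t, hδ₂W t⟩ with hη₂
  have h1 : IsMIntegralCurveOn (I := 𝓡 d) η₁ ZU J := isMIntegralCurveOn_of_subtypeVal_comp U hJ hδ₁c
  have h2 : IsMIntegralCurveOn (I := 𝓡 d) η₂ ZU J := isMIntegralCurveOn_of_subtypeVal_comp U hJ hδ₂c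
  have h12 : η₁ t₀ = η₂ t₀ := Subtype.ext (by
    show δ₁ t₀ = δ₂ t₀
    rw [hδ₁J ht₀, hδ₂J ht₀, h0])
  have key := Literature.Geometry.Manifold.eqOn_of_isMIntegralCurveOn (I := 𝓡 d) hZU1 hJ hJc ht₀ h1 h2
    h12
  intro t ht
  rw [← hδ₁J ht, ← hδ₂J ht]
  exact congrArg Subtype.val (key ht)

/-- **Orbits through a region carrying a complete flow are the flow orbits.** Let `Z` be a Killing
field of `g` on the open `W`, `N ⊆ W`, and `Φ : ℝ → M → M` with, for `x ∈ N`, `Φ 0 x = x`,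
`s ↦ Φ s x` an integral curve of `Z` staying in `N`.  Then every integral curve `γ` of `Z` on an open
order-connected `J ∋ 0` inside `W` which meets `N` at some `u ∈ J` is `s ↦ Φ (s - u) (γ u)` on `J`; in
particular `γ 0 ∈ N`.  (So an orbit starting outside `N` never enters `N`.) [cite: LeeSmoothManifolds2013, Thm. 9.12 (a)] -/
theorem IsKillingFieldOn.apply_zero_mem_of_isMIntegralCurveOn_of_mem {W N : Set M} (hWo : IsOpen W)
    (hNW : N ⊆ W) {Z : Π x : M, TangentSpace (𝓡 d) x} (hZ : g.IsKillingFieldOn Z W)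
    {Φ : ℝ → M → M} (hΦ0 : ∀ x ∈ N, Φ 0 x = x) (hΦN : ∀ x ∈ N, ∀ s, Φ s x ∈ N)
    (hΦZ : ∀ x ∈ N, IsMIntegralCurve (fun s ↦ Φ s x) Z) {γ : ℝ → M} {J : Set ℝ} (hJ : IsOpen J)
    (hJc : J.OrdConnected) (h0J : (0 : ℝ) ∈ J) (hγ : IsMIntegralCurveOn γ Z J)
    (hγW : ∀ t ∈ J, γ t ∈ W) {u : ℝ} (hu : u ∈ J) (huN : γ u ∈ N) : γ 0 ∈ N := by
  set ξ : ℝ → M := (fun s ↦ Φ s (γ u)) ∘ (· + (-u)) with hξ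
  have hξc : IsMIntegralCurve ξ Z := (hΦZ _ huN).comp_add (-u)
  have hξN : ∀ s, ξ s ∈ N := fun s ↦ hΦN _ huN _
  have heq : EqOn γ ξ J := hZ.eqOn_of_isMIntegralCurveOn hWo hJ hJc hu hγ (hξc.isMIntegralCurveOn J)
    hγW (fun s _ ↦ hNW (hξN s)) (by
      show γ u = Φ (u + -u) (γ u)
      rw [add_neg_cancel, hΦ0 _ huN])
  rw [heq h0J]
  exact hξN 0

end PseudoRiemannianMetric

end Literature.Geometry.Lorentzian

end
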